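import Summits.RiemannHypothesis.RiemannHypothesis.Theorems.SignConeConeMagnificationFakePsiMellin
import Summits.RiemannHypothesis.RiemannHypothesis.Theorems.SignConeConeMagnificationStubFakePNT
import Summits.RiemannHypothesis.RiemannHypothesis.Theorems.SignConeConeMagnificationStubChebyshev
import Summits.RiemannHypothesis.RiemannHypothesis.Theorems.SignConeConeMagnificationStubContinuation
import Summits.RiemannHypothesis.RiemannHypothesis.Theorems.SignConeConeMagnificationStubPdLaplace
import Summits.RiemannHypothesis.RiemannHypothesis.Theorems.SignConeConeMagnificationStubCara

/-!
# `ConeMagnification`: a fake von Mangoldt weight over- and under-counts the primes by `x^{Re ρ₀}`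
at every off-line zero (route `SignCone`, item stmt-RiemannHypothesis-16303; HELPER file, `--supports`)

MV Theorem 15.3 (`Literature/…/PsiOscillationFromZero.lean`: `ψ(x) − x = Ω_±(x^{Re ρ₀}/|ρ₀|)` at every zero
`ρ₀` of `ζ`, Landau's method) in its FAKE-WEIGHT version — the sharp-cutoff, two-signed, quantitative companion
of the pinch (p136750) and of the window theorem (p138600):
* `frequently_le_psi_sub_fakePsi_and_le` — for `c ≥ 0` with absolutely convergent `L_c` on `re s > 1` and
  `L_c − 1/(s−1)` the restriction of a function holomorphic on `re s > 1/2`, every zero `ρ₀` of `ζ` with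
  `Re ρ₀ > 1/2` and every `0 < κ < 1/|ρ₀|`: BOTH `ψ(x) − ψ_c(x) ≥ κ x^{Re ρ₀}` and `ψ(x) − ψ_c(x) ≤ −κ x^{Re ρ₀}`
  for arbitrarily large `x` (`ψ_c(x) = Σ_{n ≤ x} c(n)`);
* `frequently_le_psi_sub_fakePsi_and_le_of_unitSlack` — the same for every `c ≥ 0`, `c 1 = 0`, with UNIT SLACK
  against every Weil test (hypothesis of the open core `stub_designOfOffline`, in its `¬RH` world).
Proof = MV pp. 465–466 with `1 ↦ F_c(s)` (`mellinIoi_fakeCmp`): Landau's lemma on the zero-free strip near the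
real axis continues `κ/(s−b) + η(F_c + ζ₁'/ζ₁)/s` to `re s > b`, and at `s = ρ₀ + u`, `u ↓ 0`, positivity
(`re_mellinIoi_add_mul_ge`) contradicts the pole `m/u` (`re_endgame_le`).
-/

noncomputable section

-- `Summit.RiemannHypothesis.RiemannHypothesis.…` repeats a namespace component by design (D-0017 layout).
set_option linter.dupNamespace false

open scoped BigOperators ComplexConjugate Topology
open Complex Filter Topology Set MeasureTheory Metric

namespace Summit.RiemannHypothesis.RiemannHypothesis.Theorems.SignConeConeMagnification

open Literature.NumberTheory.LFunctions
open Literature.NumberTheory.LFunctions.Landau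
open Literature.NumberTheory.LFunctions.PsiOscillation

/-! ## MV Theorem 15.3 for the fake weight: the contradiction from a one-sided bound -/

/-- **The core of MV's proof of Theorem 15.3, for `ψ − ψ_c`.** Let `c ≥ 0` have absolutely convergent
`L`-series on `re s > 1` and let `L_c − 1/(s−1)` be the restriction of a function holomorphic on
`re s > 1/2`; let `ρ₀` be a zero of `ζ` with `Re ρ₀ > 1/2`, `η = ±1`, `0 < κ < 1/|ρ₀|`.  Then
`η (ψ(x) − ψ_c(x)) ≤ κ x^{Re ρ₀}` cannot hold for all large `x`. [folklore] -/
theorem false_of_eventually_psi_sub_fakePsi_le {c : ℕ → ℝ} (hc0 : ∀ n, 0 ≤ c n)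
    (hsum : ∀ σ : ℝ, 1 < σ → LSeriesSummable (fun n => ((c n : ℝ) : ℂ)) σ)
    (hcont : ∃ F : ℂ → ℂ, DifferentiableOn ℂ F {s : ℂ | 1 / 2 < s.re} ∧
      ∀ s : ℂ, 1 < s.re → F s = LSeries (fun n => ((c n : ℝ) : ℂ)) s - 1 / (s - 1))
    {ρ₀ : ℂ} (h0 : riemannZeta ρ₀ = 0) (hre : 1 / 2 < ρ₀.re) {κ η : ℝ}
    (hη : η = 1 ∨ η = -1) (hκ0 : 0 < κ) (hκ : κ < 1 / ‖ρ₀‖)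
    (hev : ∀ᶠ x : ℝ in atTop, η * (Chebyshev.psi x - ∑ n ∈ Finset.Icc 1 ⌊x⌋₊, c n) ≤ κ * x ^ ρ₀.re) :
    False := by
  -- adapted from `Literature.NumberTheory.LFunctions.PsiOscillation.false_of_eventually_le` (MV Thm 15.3)
  obtain ⟨Fc, hFcd, hFcL⟩ := hcont
  -- the zero
  have hb1 : ρ₀.re < 1 := by
    by_contra h
    exact riemannZeta_ne_zero_of_one_le_re (not_lt.1 h) h0
  have hre0 : 0 < ρ₀.re := by linarith
  have hγ : ρ₀.im ≠ 0 := im_ne_zero_of_riemannZeta_eq_zero h0 hre0 hb1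
  have hρ1 : ρ₀ ≠ 1 := by intro h; apply hγ; rw [h]; simp
  have hρ0 : ρ₀ ≠ 0 := by intro h; apply hγ; rw [h]; simp
  have hζ₁0 : riemannZeta₁ ρ₀ = 0 := (riemannZeta₁_eq_zero_iff hρ1).2 h0
  have hρn : 0 < ‖ρ₀‖ := norm_pos_iff.2 hρ0
  set b : ℝ := ρ₀.re with hbdef
  -- the fake Chebyshev function and its a-priori bound
  set P : ℝ → ℝ := fun x ↦ ∑ n ∈ Finset.Icc 1 ⌊x⌋₊, c n with hPdef
  have hPm : Measurable P := measurable_fakePsi hc0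
  obtain ⟨S, hS0, hSle⟩ := exists_fakePsi_le hc0 hsum
  -- the non-negative function `A`
  obtain ⟨X₁, hX₁⟩ := eventually_atTop.1 hev
  set X₀ : ℝ := max X₁ 1 with hX₀def
  have hX₀ : 1 ≤ X₀ := le_max_right _ _
  set A : ℝ → ℝ := fun x ↦ κ * x ^ b - η * (Chebyshev.psi x - P x) with hAdef
  have hAm : Measurable A :=
    (measurable_const.mul (measurable_id.pow_const _)).sub
      (measurable_const.mul (Nicolas.measurable_psi.sub hPm))
  have hpos : ∀ x, X₀ < x → 0 ≤ A x := fun x hx ↦ by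
    have := hX₁ x ((le_max_left _ _).trans hx.le)
    simp only [hAdef]
    linarith
  have hηabs : |η| = 1 := by rcases hη with rfl | rfl <;> norm_num
  -- `|A(x)| ≤ (κ + 7 + S) x^{3/2}` on `(1, ∞)`
  have hAbs : ∀ x, 1 < x → |A x| ≤ (κ + 7 + S) * x ^ (3 / 2 : ℝ) := fun x hx ↦ by
    simpa only [hAdef, hPdef] using abs_fakeCmp_le hc0 hSle hκ0.le (by linarith : b ≤ 3 / 2) hη hx
  -- integrability of `|A| x^{-(σ+1)}` for `σ > 3/2`
  have hIA : ∀ σ : ℝ, 3 / 2 < σ → IntegrableOn (fun x ↦ A x * x ^ (-(σ + 1))) (Ioi 1) := by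
    intro σ hσ
    have h1 : IntegrableOn (fun x : ℝ ↦ (κ + 7 + S) * (x ^ (3 / 2 : ℝ) * x ^ (-(σ + 1)))) (Ioi 1) :=
      (PsiOmega.integrableOn_rpow_rpow hσ).const_mul _
    refine Integrable.mono' h1 ((hAm.mul (measurable_id.pow_const _))).aestronglyMeasurable ?_
    rw [ae_restrict_iff' measurableSet_Ioi]
    refine Eventually.of_forall fun x (hx : 1 < x) ↦ ?_
    have hx0 : 0 < x := zero_lt_one.trans hx
    rw [norm_mul, Real.norm_eq_abs, Real.norm_eq_abs, abs_of_pos (Real.rpow_pos_of_pos hx0 _)]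
    calc |A x| * x ^ (-(σ + 1)) ≤ (κ + 7 + S) * x ^ (3 / 2 : ℝ) * x ^ (-(σ + 1)) :=
          mul_le_mul_of_nonneg_right (hAbs x hx) (Real.rpow_nonneg hx0.le _)
      _ = (κ + 7 + S) * (x ^ (3 / 2 : ℝ) * x ^ (-(σ + 1))) := by ring
  have hint : IntegrableOn (fun x ↦ A x * x ^ (-((2 : ℝ) + 1))) (Ioi 1) := hIA 2 (by norm_num)
  -- the continuation `Φ(s) = κ/(s − b) + η (F_c(s) + ζ₁'/ζ₁(s))/s`
  set Φ : ℂ → ℂ := fun s ↦ κ / (s - b) + η * ((Fc s + logDeriv riemannZeta₁ s) / s) with hΦdef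
  -- (15.6): `Φ = ∫ A x^{-s-1}` on `re s > 2`
  have hagree : EqOn Φ (mellinIoi A) {s : ℂ | (2 : ℝ) < s.re} := by
    intro s hs
    have hs2 : (2 : ℝ) < s.re := hs
    simp only [hΦdef, hAdef, hPdef]
    exact (mellinIoi_fakeCmp hc0 hsum hFcL κ η hb1 hs2).symm
  -- the zero-free strip `W₀ = {re s > b, |im s| < 2δ}`
  obtain ⟨δ, hδ, -, hgap⟩ := ZetaZeroSum.exists_gap_im
  set W₀ : Set ℂ := {s : ℂ | b < s.re ∧ -(2 * δ) < s.im ∧ s.im < 2 * δ} with hW₀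
  have hW₀o : IsOpen W₀ :=
    (isOpen_lt continuous_const Complex.continuous_re).inter
      ((isOpen_lt continuous_const Complex.continuous_im).inter
        (isOpen_lt Complex.continuous_im continuous_const))
  have hW₀c : Convex ℝ W₀ := by
    have : W₀ = {s : ℂ | b < s.re} ∩ ({s : ℂ | -(2 * δ) < s.im} ∩ {s : ℂ | s.im < 2 * δ}) := by
      ext s; simp [hW₀]
    rw [this]
    exact (convex_halfSpace_re_gt _).inter ((convex_halfSpace_im_gt _).inter (convex_halfSpace_im_lt _))
  have hW₀r : ∀ σ' : ℝ, b < σ' → σ' ≤ 2 + 1 → (σ' : ℂ) ∈ W₀ := by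
    intro σ' h1 _
    simp only [hW₀, Set.mem_setOf_eq, Complex.ofReal_re, Complex.ofReal_im]
    exact ⟨h1, by linarith, by linarith⟩
  -- `ζ₁ ≠ 0` on `{re s > 2} ∪ W₀`, `re s > b` there, and `Φ` is holomorphic there
  have hbW : ∀ s ∈ ({s : ℂ | (2 : ℝ) < s.re} ∪ W₀), b < s.re := by
    rintro s (hs | hs)
    · have hs' : (2 : ℝ) < s.re := hs
      linarith
    · exact hs.1
  have hζW : ∀ s ∈ ({s : ℂ | (2 : ℝ) < s.re} ∪ W₀), riemannZeta₁ s ≠ 0 := by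
    rintro s (hs | hs)
    · have hs' : (2 : ℝ) < s.re := hs
      have hs1 : s ≠ 1 := by rintro rfl; norm_num at hs'
      rw [Ne, riemannZeta₁_eq_zero_iff hs1]
      exact riemannZeta_ne_zero_of_one_lt_re (by linarith)
    · exact PsiOneExplicit.riemannZeta₁_ne_zero_of_abs_im_lt hgap (abs_lt.2 ⟨hs.2.1, hs.2.2⟩)
        (by linarith [hs.1])
  have hΦat : ∀ s : ℂ, b < s.re → riemannZeta₁ s ≠ 0 → DifferentiableAt ℂ Φ s := by
    intro s hbs hζ
    have hs0 : s ≠ 0 := by intro h; rw [h] at hbs; simp at hbs; linarith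
    have hsb : s ≠ (b : ℂ) := by intro h; rw [h] at hbs; simp at hbs
    have hFc : DifferentiableAt ℂ Fc s :=
      (hFcd s (show (1 : ℝ) / 2 < s.re by linarith)).differentiableAt
        ((isOpen_lt continuous_const Complex.continuous_re).mem_nhds
          (show 1 / 2 < s.re by linarith))
    have d1 : DifferentiableAt ℂ (fun z : ℂ ↦ (κ : ℂ) / (z - b)) s :=
      (differentiableAt_const _).div (differentiableAt_id.sub_const _) (sub_ne_zero.2 hsb)
    have d2 : DifferentiableAt ℂ (fun z : ℂ ↦ (Fc z + logDeriv riemannZeta₁ z) / z) s :=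
      (hFc.add (PsiOneExplicit.analyticAt_logDeriv_riemannZeta₁ hζ).differentiableAt).div
        differentiableAt_id hs0
    exact d1.add (d2.const_mul _)
  have hΦd : DifferentiableOn ℂ Φ ({s : ℂ | (2 : ℝ) < s.re} ∪ W₀) := fun s hs ↦
    (hΦat s (hbW s hs) (hζW s hs)).differentiableWithinAt
  -- Landau's lemma: absolute convergence for every `σ > b`
  have hI : ∀ σ : ℝ, b < σ → IntegrableOn (fun x ↦ A x * x ^ (-(σ + 1))) (Ioi 1) := fun σ hσ ↦
    Landau.integrableOn_of_differentiableOn_union_convex hAm hint hX₀ hpos (by linarith : b < 2)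
      hW₀o hW₀c hW₀r hΦd hagree hσ
  set F : ℂ → ℂ := mellinIoi A with hFdef
  have hFd : DifferentiableOn ℂ F {s : ℂ | b < s.re} := differentiableOn_mellinIoi_of_forall hAm hI
  -- the identity `s (s-b) ζ₁ F = κ s ζ₁ + η (s-b)(ζ₁' + F_c ζ₁)` on `re s > b`
  set Ψ : ℂ → ℂ := fun s ↦ s * (s - b) * riemannZeta₁ s * F s -
      (κ * s * riemannZeta₁ s + η * (s - b) * (deriv riemannZeta₁ s + Fc s * riemannZeta₁ s)) with hΨ
  have hΨd : DifferentiableOn ℂ Ψ {s : ℂ | b < s.re} := by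
    intro s hs
    have hbs : b < s.re := hs
    have hF : DifferentiableAt ℂ F s := (hFd s hs).differentiableAt ((isOpen_re_gt b).mem_nhds hs)
    have hz : DifferentiableAt ℂ riemannZeta₁ s := differentiable_riemannZeta₁ s
    have hdz : DifferentiableAt ℂ (deriv riemannZeta₁) s :=
      (differentiable_riemannZeta₁.analyticAt s).deriv.differentiableAt
    have hFc : DifferentiableAt ℂ Fc s :=
      (hFcd s (show (1 : ℝ) / 2 < s.re by linarith)).differentiableAt
        ((isOpen_lt continuous_const Complex.continuous_re).mem_nhds
          (show 1 / 2 < s.re by linarith))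
    apply DifferentiableAt.differentiableWithinAt
    have hid : DifferentiableAt ℂ (fun z : ℂ ↦ z) s := differentiableAt_id
    have h1 : DifferentiableAt ℂ (fun z : ℂ ↦ z * (z - b) * riemannZeta₁ z * F z) s :=
      ((hid.mul (hid.sub_const _)).mul hz).mul hF
    have h2 : DifferentiableAt ℂ
        (fun z : ℂ ↦ κ * z * riemannZeta₁ z + η * (z - b) * (deriv riemannZeta₁ z + Fc z * riemannZeta₁ z)) s :=
      (((differentiableAt_const _).mul hid).mul hz).add
        (((differentiableAt_const _).mul (hid.sub_const _)).mul (hdz.add (hFc.mul hz)))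
    exact h1.sub h2
  have hΨ0 : EqOn Ψ 0 {s : ℂ | b < s.re} := by
    have hΨa : AnalyticOnNhd ℂ Ψ {s : ℂ | b < s.re} := hΨd.analyticOnNhd (isOpen_re_gt b)
    have h3 : (3 : ℂ) ∈ {s : ℂ | (2 : ℝ) < s.re} := by simp; norm_num
    have hev3 : Ψ =ᶠ[𝓝 (3 : ℂ)] 0 := by
      filter_upwards [(isOpen_re_gt 2).mem_nhds h3] with s hs
      have hs2 : (2 : ℝ) < s.re := hs
      have hFs : F s = Φ s := (hagree hs).symm
      have hζ := hζW s (Or.inl hs)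
      have hs0 : s ≠ 0 := by intro h; rw [h] at hs2; simp at hs2; linarith
      have hsb : s - (b : ℂ) ≠ 0 := by
        intro h; have := congrArg Complex.re h; simp at this; linarith
      simp only [hΨ, hFs, hΦdef, logDeriv_apply, Pi.zero_apply]
      field_simp
      ring
    have h3' : (3 : ℂ) ∈ {s : ℂ | b < s.re} := by simp; linarith
    exact hΨa.eqOn_zero_of_preconnected_of_eventuallyEq_zero
      (convex_halfSpace_re_gt b).isPreconnected h3' hev3
  -- local structure at `ρ₀`
  obtain ⟨m, h, r, hm, hr, hha, hh0, hhne, hhd, hfac, hlog⟩ := exists_logDeriv_riemannZeta₁_eq hζ₁0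
  have hFcρ : ContinuousAt Fc ρ₀ :=
    ((hFcd ρ₀ (show 1 / 2 < ρ₀.re from hre)).differentiableAt
      ((isOpen_lt continuous_const Complex.continuous_re).mem_nhds (show 1 / 2 < ρ₀.re from hre))).continuousAt
  have hDc : ContinuousAt (fun z ↦ deriv h z / h z + Fc z - 1) ρ₀ :=
    ((hha.deriv.continuousAt.div hha.continuousAt hh0).add hFcρ).sub continuousAt_const
  set B₀ : ℝ := ‖deriv h ρ₀ / h ρ₀ + Fc ρ₀ - 1‖ + 1 with hB₀
  have hDev : ∀ᶠ z in 𝓝 ρ₀, ‖deriv h z / h z + Fc z - 1‖ ≤ B₀ :=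
    (hDc.norm.eventually (eventually_lt_nhds (by linarith : ‖deriv h ρ₀ / h ρ₀ + Fc ρ₀ - 1‖ < B₀))).mono
      fun z hz ↦ hz.le
  -- the kernel `(F_c(σ) + ζ₁'/ζ₁(σ))/σ` is bounded on the real segment `[b, 3]`
  have hQc : ContinuousOn (fun σ : ℝ ↦ (Fc σ + logDeriv riemannZeta₁ σ) / (σ : ℂ)) (Icc b 3) := by
    intro σ hσ
    have hσ0 : 0 < σ := by linarith [hσ.1]
    have hσh : 1 / 2 < ((σ : ℂ)).re := by simp; linarith [hσ.1]
    have hFc : ContinuousAt Fc (σ : ℂ) :=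
      ((hFcd σ hσh).differentiableAt
        ((isOpen_lt continuous_const Complex.continuous_re).mem_nhds hσh)).continuousAt
    have hQσ : ContinuousAt (fun z : ℂ ↦ (Fc z + logDeriv riemannZeta₁ z) / z) (σ : ℂ) :=
      (hFc.add (PsiOneExplicit.analyticAt_logDeriv_riemannZeta₁
        (riemannZeta₁_ofReal_ne_zero hσ0)).continuousAt).div continuous_id.continuousAt
          (ofReal_ne_zero.2 hσ0.ne')
    exact (hQσ.comp continuous_ofReal.continuousAt).continuousWithinAt
  obtain ⟨C₁, hC₁⟩ := isCompact_Icc.exists_bound_of_continuousOn hQc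
  -- the head constant `C₀`
  have hloc : IntegrableOn (fun x ↦ |A x| * x ^ (-(b + 1))) (Ioc 1 X₀) := by
    refine Measure.integrableOn_of_bounded measure_Ioc_lt_top.ne
      (((continuous_abs.measurable.comp hAm).mul (measurable_id.pow_const _))).aestronglyMeasurable
      (M := (κ + 7 + S) * X₀ ^ (3 / 2 : ℝ)) ?_
    rw [ae_restrict_iff' measurableSet_Ioc]
    refine Eventually.of_forall fun x hx ↦ ?_
    have hx0 : 0 < x := zero_lt_one.trans hx.1
    have hpow : x ^ (-(b + 1)) ≤ 1 := Real.rpow_le_one_of_one_le_of_nonpos hx.1.le (by linarith)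
    have hKS : 0 ≤ κ + 7 + S := by linarith
    rw [Real.norm_eq_abs, abs_mul, abs_abs, abs_of_pos (Real.rpow_pos_of_pos hx0 _)]
    calc |A x| * x ^ (-(b + 1)) ≤ (κ + 7 + S) * x ^ (3 / 2 : ℝ) * 1 :=
          mul_le_mul (hAbs x hx.1) hpow (Real.rpow_nonneg hx0.le _) (by positivity)
      _ ≤ (κ + 7 + S) * X₀ ^ (3 / 2 : ℝ) := by
          rw [mul_one]
          exact mul_le_mul_of_nonneg_left (Real.rpow_le_rpow hx0.le hx.2 (by norm_num)) hKS
  set C₀ : ℝ := 2 * ∫ x in Ioc 1 X₀, |A x| * x ^ (-(b + 1)) with hC₀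
  -- the total `O(1)` constant and the choice of `u`
  set T : ℝ := C₁ + κ / |ρ₀.im| + m / ρ₀.im ^ 2 + (B₀ + 1) / |ρ₀.im| with hT
  have hgap' : 0 < 1 / ‖ρ₀‖ - κ := by linarith
  have htend : Tendsto (fun u : ℝ ↦ ρ₀ + (u : ℂ)) (𝓝[>] 0) (𝓝 ρ₀) := by
    have hc : Continuous (fun u : ℝ ↦ ρ₀ + (u : ℂ)) := continuous_const.add continuous_ofReal
    have h := hc.tendsto 0
    simp only [ofReal_zero, add_zero] at h
    exact h.mono_left nhdsWithin_le_nhds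
  have e1 : ∀ᶠ u : ℝ in 𝓝[>] 0, ‖deriv h (ρ₀ + u) / h (ρ₀ + u) + Fc (ρ₀ + u) - 1‖ ≤ B₀ :=
    htend.eventually hDev
  have e2 : ∀ᶠ u : ℝ in 𝓝[>] 0, ρ₀ + (u : ℂ) ∈ ball ρ₀ r :=
    htend.eventually (isOpen_ball.mem_nhds (mem_ball_self hr))
  have e3 : ∀ᶠ u : ℝ in 𝓝[>] 0, u < 1 := nhdsWithin_le_nhds (Iio_mem_nhds one_pos)
  have e4 : ∀ᶠ u : ℝ in 𝓝[>] 0, u * (|T| + |C₀| + 1) < 1 / ‖ρ₀‖ - κ := by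
    have ht : Tendsto (fun u : ℝ ↦ u * (|T| + |C₀| + 1)) (𝓝 0) (𝓝 0) := by
      have := (tendsto_id (x := 𝓝 (0 : ℝ))).mul_const (|T| + |C₀| + 1)
      simpa using this
    exact nhdsWithin_le_nhds (ht (Iio_mem_nhds hgap'))
  have e0 : ∀ᶠ u : ℝ in 𝓝[>] 0, 0 < u := self_mem_nhdsWithin
  obtain ⟨u, hu0, huB, hur, hu1, huT⟩ := (e0.and (e1.and (e2.and (e3.and e4)))).exists
  -- the two points `s = ρ₀ + u` and `σ = b + u`
  set s : ℂ := ρ₀ + u with hsdef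
  set σ : ℝ := b + u with hσdef
  have hsre : s.re = σ := by simp [hsdef, hσdef, hbdef]
  have hσb : b < σ := by rw [hσdef]; linarith
  have hsH : s ∈ {z : ℂ | b < z.re} := by
    show b < s.re
    rw [hsre]; exact hσb
  have hσH : ((σ : ℝ) : ℂ) ∈ {z : ℂ | b < z.re} := by
    show b < ((σ : ℝ) : ℂ).re
    rw [ofReal_re]; exact hσb
  have hsρ : s ≠ ρ₀ := by
    intro h
    have := congrArg Complex.re h
    rw [hsre, hσdef] at this
    linarith
  have hζs : riemannZeta₁ s ≠ 0 := by
    rw [hfac s hur]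
    exact mul_ne_zero (pow_ne_zero _ (sub_ne_zero.2 hsρ)) (hhne s hur)
  have hsim : s.im = ρ₀.im := by simp [hsdef]
  have hs0 : s ≠ 0 := by intro h; apply hγ; rw [← hsim, h]; simp
  have hsb0 : s - (b : ℂ) ≠ 0 := by
    intro h; apply hγ
    have := congrArg Complex.im h
    simpa [hsim] using this
  have hsu : s - ρ₀ = u := by simp [hsdef]
  -- `F(s) = κ/(s−b) + η (m/u + (h'/h(s) + F_c(s) − 1) + 1)/s`
  have hFs : F s = κ / (s - b) + η * (((m : ℂ) / u + (deriv h s / h s + Fc s - 1) + 1) / s) := by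
    have h1 := hΨ0 hsH
    simp only [hΨ, Pi.zero_apply, sub_eq_zero] at h1
    have h2 := hlog s hur hsρ
    rw [hsu] at h2
    have h3 : F s = (κ * s * riemannZeta₁ s + η * (s - b) * (deriv riemannZeta₁ s + Fc s * riemannZeta₁ s)) /
        (s * (s - b) * riemannZeta₁ s) := by
      rw [← h1]; field_simp
    have h4 : deriv riemannZeta₁ s = riemannZeta₁ s * (m / u + deriv h s / h s) := by
      rw [← h2]; field_simp
    rw [h3, h4]
    field_simp
    ring
  -- `F(σ) = κ/u + η Q(σ)`
  have hσ0' : 0 < σ := by linarith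
  have hζσ : riemannZeta₁ (σ : ℂ) ≠ 0 := riemannZeta₁_ofReal_ne_zero hσ0'
  have hσ0 : ((σ : ℝ) : ℂ) ≠ 0 := ofReal_ne_zero.2 hσ0'.ne'
  have hσbu : ((σ : ℝ) : ℂ) - b = u := by rw [hσdef]; push_cast; ring
  have huC : (u : ℂ) ≠ 0 := ofReal_ne_zero.2 hu0.ne'
  have hFσ : F σ = κ / u + η * ((Fc σ + logDeriv riemannZeta₁ σ) / (σ : ℂ)) := by
    have h1 := hΨ0 hσH
    simp only [hΨ, Pi.zero_apply, sub_eq_zero] at h1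
    rw [hσbu] at h1
    have h3 : F σ = (κ * σ * riemannZeta₁ σ + η * u * (deriv riemannZeta₁ σ + Fc σ * riemannZeta₁ σ)) /
        (σ * u * riemannZeta₁ σ) := by
      rw [← h1]; field_simp
    rw [h3, logDeriv_apply]
    field_simp
    ring
  -- the bounds
  have hq : ‖(Fc σ + logDeriv riemannZeta₁ σ) / (σ : ℂ)‖ ≤ C₁ := hC₁ σ ⟨hσb.le, by linarith⟩
  set w : ℂ := -η * ρ₀ / (‖ρ₀‖ : ℂ) with hwdef
  have hw1 : ‖w‖ ≤ 1 := by
    rw [hwdef, norm_div, norm_mul, norm_neg, Complex.norm_real, Real.norm_eq_abs, hηabs, one_mul,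
      Complex.norm_real, Real.norm_eq_abs, abs_of_pos hρn, div_self hρn.ne']
  have hlow := re_mellinIoi_add_mul_ge hAm hX₀ hpos hσb.le (hI σ hσb) hloc hsre hw1
  have hup := re_endgame_le (C₁ := C₁) (q := (Fc σ + logDeriv riemannZeta₁ σ) / (σ : ℂ))
    (D := deriv h s / h s + Fc s - 1) hη hu0 hm hκ0.le hγ hsdef hwdef hq huB
  have heq : mellinIoi A σ + w * mellinIoi A s = (κ / u : ℂ) + η * ((Fc σ + logDeriv riemannZeta₁ σ) / (σ : ℂ)) +
      w * (κ / (s - (ρ₀.re : ℂ)) + η * (((m : ℂ) / u + (deriv h s / h s + Fc s - 1) + 1) / s)) := by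
    change F σ + w * F s = _
    rw [hFσ, hFs]
  rw [heq] at hlow
  have h1 : -C₀ ≤ (κ - 1 / ‖ρ₀‖) / u + T := hlow.trans hup
  -- contradiction
  have h2 : |T| + |C₀| + 1 < (1 / ‖ρ₀‖ - κ) / u := by
    rw [lt_div_iff₀ hu0]; linarith
  have h3 : (κ - 1 / ‖ρ₀‖) / u = -((1 / ‖ρ₀‖ - κ) / u) := by ring
  rw [h3] at h1
  linarith [le_abs_self T, le_abs_self C₀]

/-- **MV Theorem 15.3 for a fake von Mangoldt weight (`Ω₊` and `Ω₋`).**  Let `c ≥ 0` have absolutely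
convergent `L`-series on `re s > 1` and let `L_c(s) − 1/(s−1)` be the restriction to `re s > 1` of a function
holomorphic on `re s > 1/2`.  For every zero `ρ₀` of `ζ` with `Re ρ₀ > 1/2` and every `0 < κ < 1/|ρ₀|`:
`ψ(x) − ψ_c(x) ≥ κ x^{Re ρ₀}` for arbitrarily large `x` AND `ψ(x) − ψ_c(x) ≤ −κ x^{Re ρ₀}` for arbitrarily large
`x`, where `ψ_c(x) = Σ_{1 ≤ n ≤ x} c(n)`.  (In the `¬RH` world of the open core a fake weight under-counts and
over-counts the primes by `x^{Re ρ₀}/|ρ₀|` infinitely often.) [folklore] -/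
theorem frequently_le_psi_sub_fakePsi_and_le :
    ∀ c : ℕ → ℝ, (∀ n, 0 ≤ c n) →
    (∀ σ : ℝ, 1 < σ → LSeriesSummable (fun n => ((c n : ℝ) : ℂ)) σ) →
    (∃ F : ℂ → ℂ, DifferentiableOn ℂ F {s : ℂ | 1 / 2 < s.re} ∧
      ∀ s : ℂ, 1 < s.re → F s = LSeries (fun n => ((c n : ℝ) : ℂ)) s - 1 / (s - 1)) →
    ∀ ρ₀ : ℂ, riemannZeta ρ₀ = 0 → 1 / 2 < ρ₀.re → ∀ κ : ℝ, 0 < κ → κ < 1 / ‖ρ₀‖ →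
      (∃ᶠ x : ℝ in atTop, κ * x ^ ρ₀.re ≤ Chebyshev.psi x - ∑ n ∈ Finset.Icc 1 ⌊x⌋₊, c n) ∧
      (∃ᶠ x : ℝ in atTop, Chebyshev.psi x - ∑ n ∈ Finset.Icc 1 ⌊x⌋₊, c n ≤ -(κ * x ^ ρ₀.re)) := by
  intro c hc0 hsum hcont ρ₀ h0 hre κ hκ0 hκ
  constructor
  · by_contra h
    refine false_of_eventually_psi_sub_fakePsi_le hc0 hsum hcont h0 hre (Or.inl rfl) hκ0 hκ ?_
    filter_upwards [not_frequently.1 h] with x hx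
    rw [one_mul]
    exact (not_le.1 hx).le
  · by_contra h
    refine false_of_eventually_psi_sub_fakePsi_le hc0 hsum hcont h0 hre (Or.inr rfl) hκ0 hκ ?_
    filter_upwards [not_frequently.1 h] with x hx
    have := not_le.1 hx
    linarith

/-- **The same for every unit-slack weight** (the hypothesis of the open core `stub_designOfOffline`):
if `c ≥ 0` has unit slack against every Weil test (so `L_c` converges absolutely on `re s > 1` by
`stub_fakePNT`/`stub_chebyshev` and `L_c − 1/(s−1)` continues to `re s > 1/2` by `stub_continuation`), then
at every zero `ρ₀` of `ζ` off the critical line to the right (`Re ρ₀ > 1/2`) the fake Chebyshev function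
`ψ_c` differs from `ψ` by at least `κ x^{Re ρ₀}` in BOTH directions, infinitely often, for every
`κ < 1/|ρ₀|`. [folklore] -/
theorem frequently_le_psi_sub_fakePsi_and_le_of_unitSlack :
    ∀ c : ℕ → ℝ, (∀ n, 0 ≤ c n) → c 1 = 0 →
    (∀ g : ℝ → ℂ, IsWeilTest g →
      -(∫ t, ‖g t‖ ^ 2) ≤
        (weilPolarTerm (weilConv g (weilReflect g)) + weilArchTerm (weilConv g (weilReflect g)) -
          ∑' n : ℕ, ((c n : ℝ) : ℂ) / (Real.sqrt n : ℂ) *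
            (weilConv g (weilReflect g) (Real.log n) + weilConv g (weilReflect g) (-Real.log n))).re) →
    ∀ ρ₀ : ℂ, riemannZeta ρ₀ = 0 → 1 / 2 < ρ₀.re → ∀ κ : ℝ, 0 < κ → κ < 1 / ‖ρ₀‖ →
      (∃ᶠ x : ℝ in atTop, κ * x ^ ρ₀.re ≤ Chebyshev.psi x - ∑ n ∈ Finset.Icc 1 ⌊x⌋₊, c n) ∧
      (∃ᶠ x : ℝ in atTop, Chebyshev.psi x - ∑ n ∈ Finset.Icc 1 ⌊x⌋₊, c n ≤ -(κ * x ^ ρ₀.re)) := by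
  intro c hc0 hc1 hU
  -- the landed chain of line `Sketch` (as in `ConeMagnification_of_subs`)
  have hPNT := stub_fakePNT c hc0 hU
  have hsum := stub_chebyshev c hc0 hPNT
  have hcont := Summit.RiemannHypothesis.RiemannHypothesis.Cruxes.ConeMagnification.Sketch.stub_continuation
    c hc0 hPNT hsum
  have hPD := stub_pdLaplace c hc0 hU
  obtain ⟨F, hFd, hFL, -⟩ :=
    stub_cara c hc0 hc1 hU hsum hcont hPD
  exact frequently_le_psi_sub_fakePsi_and_le c hc0 hsum ⟨F, hFd, hFL⟩

end Summit.RiemannHypothesis.RiemannHypothesis.Theorems.SignConeConeMagnification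

end
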